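import Literature.MathematicalPhysics.QuantumFieldTheory.Balaban1983to89.B9KnitRows1517AtPinnedShapesY

/-!
# `Balaban1983to89.B9KnitRows1517AlongSectionsY` — T. Bałaban, *Propagators for lattice gauge theories in a background field*, Commun. Math. Phys. **99** (1985)
# 389–434 [Balaban1985BackgroundPropagators], Thm 3.2 (3.48) p. 398 and Thm 3.11 p. 416 AT THE KNIT RECORD, RE-INDEXED ALONG A SUB-FAMILY CARRYING SECTIONS: the
# knit certificate's rows-15∕16 display `h348` and row-17 display `hΔAK` in the J-indexed shape `∀ j, … (f j) …` that a certificate quantifying its sub-family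
# `f : J → MemberY …` together with sections `ιB j` of `β` (`hι`) would carry — both LAW-FREE there (every `f j` is section-carrying)

statement-level skeleton of published theorems with citation tags; proofs where landed; nothing here is a claim about the Yang–Mills mass gap

THE PRINT.  Thm 3.2 (3.48) p. 398, (3.96) p. 411; Thm 3.11 p. 416; Thm 3.3 p. 399; (3.26)–(3.27) p. 395; (3.19) p. 393; (3.35) p. 396; (3.115) p. 418;
[4] (2.3) p. 224, (2.45) p. 231, (2.51) p. 232, p. 248; [5] Prop. 2 (52)–(53) p. 26.

WHY THIS FILE (cell `pub-ymgap`, node N06, seat `dag-n06-j` gen 37 = bundle F5 rows 15–17).  The knit certificates («KA» … «KE₃X», dag-n06-d) display `h348` and `hΔAK`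
over ALL members `x : MemberY …`, while the K1 face of record instantiates the certificate's sub-family at the section-carrying carrier (`J := SCMemberY`, `ιB := ιBsc`);
this seat's `B9Thm32Conv348AtKnitLetterOfRegYP335` ∕ `B9KnitRows1517AtPinnedShapesY` (rows 15–16) and `B9Thm311PosDefQknitAtKnitLetterLawFreeY` (row 17) prove both
rows at every section-carrying member.  A re-indexing edition of the certificate (the rows asked along `(f, ιB, hι)` only, as the coded Sect.-B step `hBK` already is)
would display exactly the two statements below — THIS FILE types them once, so that such an edition needs no further supplier: §1 is the `h348` binder of
`B9Thm39FacesAlongSubfamilyRC.t39_hksum_oneCube_opsYOfLetters_FRC_along` (g32) at letters pinned to the knit pair, §2 the `hΔAK` conjunction along `f`; the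
surjectivity of `β` at `f j` is read off the section (`⟨ιB j s, hι j s⟩`).

WHAT IS PROVED (sorry-free; 0 `def`; 3-line corollaries).
* §1 `conv348_oneCubeYFR_knitPins_along_sections` (+ the `oneCubeOps39 … (𝔏 (f j)).Gp` typing `conv348_oneCube_parKnitY_letters_along_sections`) — rows 15–16 along `(f, ιB, hι)`.
* §2 ★ `symm_posDefTr_deltaAQY_knitRecord_along_sections` — row 17's `IsSymmTr ∧ PosDefTr` of `Δ_a^𝔮(U)` at the knit pair along `(f, ιB, hι)`, R-generic premise.
HONEST SCOPE.  Re-indexing of landed theorems; no estimate asserted or re-proved; the ALL-member displays are NOT discharged by this file (inner-corner members have no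
section); helper, count-neutral; N06 NOT discharged; nothing continuum ∕ OS ∕ mass gap ∕ Clay — the Yang–Mills mass gap is NOT proved here.  No `sorry`, no `axiom`, no
`instance`, no `notation`, no `def`.  NEW file.
RELATED, NOT DUPLICATED (searched 2026-08-31: `rg -l -w "KnitRows1517AlongSections|conv348_oneCubeYFR_knitPins_along_sections|symm_posDefTr_deltaAQY_knitRecord_along_sections"`
over `lean/{Literature,Summits,HarnessLib}` = ∅): g32 `B9Thm39FacesAlongSubfamilyRC` (the same re-indexing at `parSymY`, and the J-indexed READER §1 feeds), the three
parents above (USED).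
-/

noncomputable section

namespace Literature.MathematicalPhysics.QuantumFieldTheory.Balaban1983to89.B9KnitRows1517AlongSectionsY

open Literature.MathematicalPhysics.QuantumFieldTheory.Balaban1983to89
open Node00 B9Thm311ReadingCoords B9Thm39WholeBlk B9Thm39ReadingCoords B9Thm39ReadingAtLetters B9Thm39OneCubeReadingAtLettersY B9Thm39PureGaugeClassAtLettersR
  B6KLevelCensusIndexV1 B6Ineq2142KLevelV1 B6GlobalChartV1 B9PinMembersKLevelV1 B9PinGeometryKLevelV1 B9GeoNormsKLevelV1
  B9BackgroundsKLevelV1 B9BackgroundsKLevelV1P B9BackgroundsKLevelV1R B7Prop2SpecialUnitary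
open Literature.MathematicalPhysics.QuantumFieldTheory.Balaban1983to89.B9Ineq349SiteFromConv348 (blk39F)
open Literature.MathematicalPhysics.QuantumFieldTheory.Balaban1983to89.B9B8AveragingJunction (parKnitY)
open Literature.MathematicalPhysics.QuantumFieldTheory.Balaban1983to89.Node00.OpsYQLetter (qKnitOfRecord qsKnitOfRecord)
open Literature.MathematicalPhysics.QuantumFieldTheory.Balaban1983to89.B9Thm32Conv348AtKnitLetterOfRegYP335 (conv348_oneCube_parKnitY_of_regYR_section_letters)
open Literature.MathematicalPhysics.QuantumFieldTheory.Balaban1983to89.B9KnitRows1517AtPinnedShapesY (conv348_oneCubeYFR_knitPins_of_regYR_section)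
open Literature.MathematicalPhysics.QuantumFieldTheory.Balaban1983to89.B9Thm311PosDefQknitAtKnitLetterLawFreeY (symm_posDefTr_deltaAQY_knitRecord_at_scMember_regYR)
open scoped Matrix.Norms.L2Operator

variable {N : ℕ} (θ : Stage3Params) (Mstar : ℕ)

/-! ## §1 Rows 15–16 along a sub-family with sections (knit-pinned letters) -/

section Rows1516

variable [∀ x : MemberY θ.d₆ θ.ℓ₆ θ.hd' θ.hL' θ.b₀ θ.b₁ Mstar, Fintype (geo9Y x).Site]

/-- ★ **ROWS 15–16 ALONG `(f, ιB, hι)` IN THE `oneCubeOps39YFR` TYPING, KNIT-PINNED LETTERS** — the `h348` binder of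
`B9Thm39FacesAlongSubfamilyRC.t39_hksum_oneCube_opsYOfLetters_FRC_along`, discharged at every member of a sub-family carrying sections (R-generic premise).
[cite: Balaban1985BackgroundPropagators, Thm 3.2 (3.48) p.398 + (3.96) p.411 + (3.19) p.393 + (3.35) p.396; Balaban1984PropagatorsII, (2.3) p.224 + (2.45) p.231 + (2.51) p.232 + p.248] -/
theorem conv348_oneCubeYFR_knitPins_along_sections (hN : 1 ≤ N) (𝔏 : LettersY N θ Mstar)
    (hP : ∀ x : MemberY θ.d₆ θ.ℓ₆ θ.hd' θ.hL' θ.b₀ θ.b₁ Mstar, (𝔏 x).parS = parKnitY x.toKIdx)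
    (hGp : ∀ x : MemberY θ.d₆ θ.ℓ₆ θ.hd' θ.hL' θ.b₀ θ.b₁ Mstar, (𝔏 x).Gp = GpY x.toKIdx (parKnitY x.toKIdx))
    {R₁ R₂ : RegFamY θ.d₆ θ.ℓ₆ θ.hd' θ.hL' θ.b₀ θ.b₁ Mstar (Matrix (Fin N) (Fin N) ℂ)} {c : ℝ} (hc : 0 < c)
    (hRP1 : ∀ (x : MemberY θ.d₆ θ.ℓ₆ θ.hd' θ.hL' θ.b₀ θ.b₁ Mstar) (α₀ : ℝ)
      (U : (bg9YR (Matrix (Fin N) (Fin N) ℂ) (specialUnitaryUnits (Fin N)) R₁ R₂ x).Cfg),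
      (bg9YR (Matrix (Fin N) (Fin N) ℂ) (specialUnitaryUnits (Fin N)) R₁ R₂ x).Reg335 c α₀ U →
        0 ≤ α₀ ∧ (bg9YP (Matrix (Fin N) (Fin N) ℂ) (specialUnitaryUnits (Fin N)) x).Reg335 c35Y α₀ U) :
    ∃ M₁ a₁ B₀ δ₀ : ℝ, 0 < M₁ ∧ 0 < a₁ ∧ 0 < B₀ ∧ 0 < δ₀ ∧
    ∀ (bI : ∀ x : MemberY θ.d₆ θ.ℓ₆ θ.hd' θ.hL' θ.b₀ θ.b₁ Mstar, FBondY x.toKIdx → IBondY x.toKIdx)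
      (_hβI : ∀ (x : MemberY θ.d₆ θ.ℓ₆ θ.hd' θ.hL' θ.b₀ θ.b₁ Mstar) (b : FBondY x.toKIdx) (c : IBondY x.toKIdx),
        blkV1 x.hN x.D b = β x.hN x.D x.hk c → β x.hN x.D x.hk (bI x b) = blkV1 x.hN x.D b)
      {J : Type} (f : J → MemberY θ.d₆ θ.ℓ₆ θ.hd' θ.hL' θ.b₀ θ.b₁ Mstar) (ιB : ∀ j : J, BlkY (f j).toKIdx → IBondY (f j).toKIdx)
      (_hι : ∀ (j : J) (s : BlkY (f j).toKIdx), β (f j).toKIdx.hN (f j).toKIdx.D (f j).toKIdx.hk (ιB j s) = s)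
      (j : J), M₁ ≤ (geo9Y (f j)).M → ∀ α₀ : ℝ, 0 < α₀ → c * (geo9Y (f j)).M * α₀ ≤ a₁ →
      ∀ U : (bg9YR (Matrix (Fin N) (Fin N) ℂ) (specialUnitaryUnits (Fin N)) R₁ R₂ (f j)).Cfg,
        (bg9YR (Matrix (Fin N) (Fin N) ℂ) (specialUnitaryUnits (Fin N)) R₁ R₂ (f j)).Reg335 c α₀ U →
        Conv348Blk (oneCubeOps39YFR θ Mstar 𝔏 R₁ R₂ bI (f j)) B₀ δ₀ U := by
  obtain ⟨M₁, a₁, B₀, δ₀, hM₁, ha₁, hB₀, hδ₀, h⟩ := conv348_oneCubeYFR_knitPins_of_regYR_section (N := N) θ Mstar hN 𝔏 hP hGp hc hRP1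
  exact ⟨M₁, a₁, B₀, δ₀, hM₁, ha₁, hB₀, hδ₀, fun bI hβI J f ιB hι j hM α₀ hα ha U hU =>
    h bI hβI (f j) (fun s => ⟨ιB j s, hι j s⟩) hM α₀ hα ha U hU⟩

/-- **THE SAME IN THE `oneCubeOps39 … (L39 x (parKnitY x) (𝔏 x).Gp)` TYPING** («KA»'s `h348` letter shape, only the `G′`-pin needed), along `(f, ιB, hι)`.
[cite: Balaban1985BackgroundPropagators, Thm 3.2 (3.48) p.398 + (3.96) p.411 + (3.19) p.393 + (3.35) p.396; Balaban1984PropagatorsII, (2.3) p.224 + (2.45) p.231 + p.248] -/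
theorem conv348_oneCube_parKnitY_letters_along_sections (hN : 1 ≤ N) (𝔏 : LettersY N θ Mstar)
    (hGp : ∀ x : MemberY θ.d₆ θ.ℓ₆ θ.hd' θ.hL' θ.b₀ θ.b₁ Mstar, (𝔏 x).Gp = GpY x.toKIdx (parKnitY x.toKIdx))
    {R₁ R₂ : RegFamY θ.d₆ θ.ℓ₆ θ.hd' θ.hL' θ.b₀ θ.b₁ Mstar (Matrix (Fin N) (Fin N) ℂ)} {c : ℝ} (hc : 0 < c)
    (hRP1 : ∀ (x : MemberY θ.d₆ θ.ℓ₆ θ.hd' θ.hL' θ.b₀ θ.b₁ Mstar) (α₀ : ℝ)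
      (U : (bg9YR (Matrix (Fin N) (Fin N) ℂ) (specialUnitaryUnits (Fin N)) R₁ R₂ x).Cfg),
      (bg9YR (Matrix (Fin N) (Fin N) ℂ) (specialUnitaryUnits (Fin N)) R₁ R₂ x).Reg335 c α₀ U →
        0 ≤ α₀ ∧ (bg9YP (Matrix (Fin N) (Fin N) ℂ) (specialUnitaryUnits (Fin N)) x).Reg335 c35Y α₀ U) :
    ∃ M₁ a₁ B₀ δ₀ : ℝ, 0 < M₁ ∧ 0 < a₁ ∧ 0 < B₀ ∧ 0 < δ₀ ∧
    ∀ (bI : ∀ x : MemberY θ.d₆ θ.ℓ₆ θ.hd' θ.hL' θ.b₀ θ.b₁ Mstar, FBondY x.toKIdx → IBondY x.toKIdx)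
      (_hβI : ∀ (x : MemberY θ.d₆ θ.ℓ₆ θ.hd' θ.hL' θ.b₀ θ.b₁ Mstar) (b : FBondY x.toKIdx) (c : IBondY x.toKIdx),
        blkV1 x.hN x.D b = β x.hN x.D x.hk c → β x.hN x.D x.hk (bI x b) = blkV1 x.hN x.D b)
      {J : Type} (f : J → MemberY θ.d₆ θ.ℓ₆ θ.hd' θ.hL' θ.b₀ θ.b₁ Mstar) (ιB : ∀ j : J, BlkY (f j).toKIdx → IBondY (f j).toKIdx)
      (_hι : ∀ (j : J) (s : BlkY (f j).toKIdx), β (f j).toKIdx.hN (f j).toKIdx.D (f j).toKIdx.hk (ιB j s) = s)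
      (j : J), M₁ ≤ (geo9Y (f j)).M → ∀ α₀ : ℝ, 0 < α₀ → c * (geo9Y (f j)).M * α₀ ≤ a₁ →
      ∀ U : (bg9YR (Matrix (Fin N) (Fin N) ℂ) (specialUnitaryUnits (Fin N)) R₁ R₂ (f j)).Cfg,
        (bg9YR (Matrix (Fin N) (Fin N) ℂ) (specialUnitaryUnits (Fin N)) R₁ R₂ (f j)).Reg335 c α₀ U →
        Conv348Blk (oneCubeOps39 (geo9Y (f j)) (bg9YR (Matrix (Fin N) (Fin N) ℂ) (specialUnitaryUnits (Fin N)) R₁ R₂ (f j))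
          (blk39F (Matrix (Fin N) (Fin N) ℂ) (f j).toKIdx (bI (f j))) (L39 (f j).toKIdx (parKnitY (f j).toKIdx) (𝔏 (f j)).Gp)) B₀ δ₀ U := by
  obtain ⟨M₁, a₁, B₀, δ₀, hM₁, ha₁, hB₀, hδ₀, h⟩ := conv348_oneCube_parKnitY_of_regYR_section_letters (N := N) θ Mstar hN 𝔏 hGp hc hRP1
  exact ⟨M₁, a₁, B₀, δ₀, hM₁, ha₁, hB₀, hδ₀, fun bI hβI J f ιB hι j hM α₀ hα ha U hU =>
    h bI hβI (f j) (fun s => ⟨ιB j s, hι j s⟩) hM α₀ hα ha U hU⟩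

end Rows1516

/-! ## §2 Row 17 along a sub-family with sections (the knit pair of record) -/

section Row17

variable [Nonempty (Fin N)]

/-- ★ **ROW 17 (`IsSymmTr ∧ PosDefTr` of `Δ_a^𝔮(U)` at the knit pair) ALONG `(f, ιB, hι)`, LAW-FREE** — «KA»'s `hΔAK` binder re-indexed along the certificate's own
sub-family (R-generic premise, guard `M·α₀ ≦ a₁∕c`): Theorem 3.11 at the knit record (`symm_posDefTr_deltaAQY_knitRecord_at_scMember_regYR`), surjectivity of `β` at
`f j` read off the section. [cite: Balaban1985BackgroundPropagators, Thm 3.11 p.416 + Thm 3.3 p.399 + (3.26)–(3.27) p.395 + (3.19) p.393 + (3.35) p.396 + (3.115) p.418; Balaban1985Averaging, Prop. 2 (52)–(53) p.26; Balaban1984PropagatorsII, (2.3) p.224 + (2.45) p.231] -/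
theorem symm_posDefTr_deltaAQY_knitRecord_along_sections
    {R₁ R₂ : RegFamY θ.d₆ θ.ℓ₆ θ.hd' θ.hL' θ.b₀ θ.b₁ Mstar (Matrix (Fin N) (Fin N) ℂ)} {c : ℝ} (hc : 0 < c)
    (hRP1 : ∀ (x : MemberY θ.d₆ θ.ℓ₆ θ.hd' θ.hL' θ.b₀ θ.b₁ Mstar) (α₀ : ℝ)
      (U : (bg9YR (Matrix (Fin N) (Fin N) ℂ) (specialUnitaryUnits (Fin N)) R₁ R₂ x).Cfg),
      (bg9YR (Matrix (Fin N) (Fin N) ℂ) (specialUnitaryUnits (Fin N)) R₁ R₂ x).Reg335 c α₀ U →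
        0 ≤ α₀ ∧ (bg9YP (Matrix (Fin N) (Fin N) ℂ) (specialUnitaryUnits (Fin N)) x).Reg335 c35Y α₀ U) :
    ∃ M₁ a₁ : ℝ, 0 < M₁ ∧ 0 < a₁ ∧
    ∀ {J : Type} (f : J → MemberY θ.d₆ θ.ℓ₆ θ.hd' θ.hL' θ.b₀ θ.b₁ Mstar) (ιB : ∀ j : J, BlkY (f j).toKIdx → IBondY (f j).toKIdx)
      (_hι : ∀ (j : J) (s : BlkY (f j).toKIdx), β (f j).toKIdx.hN (f j).toKIdx.D (f j).toKIdx.hk (ιB j s) = s)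
      (j : J), M₁ ≤ (geo9Y (f j)).M → ∀ α₀ : ℝ, 0 < α₀ → (geo9Y (f j)).M * α₀ ≤ a₁ / c →
      ∀ U : (bg9YR (Matrix (Fin N) (Fin N) ℂ) (specialUnitaryUnits (Fin N)) R₁ R₂ (f j)).Cfg,
        (bg9YR (Matrix (Fin N) (Fin N) ℂ) (specialUnitaryUnits (Fin N)) R₁ R₂ (f j)).Reg335 c α₀ U →
          IsSymmTr (fun _ => (1 : ℝ)) (deltaAQY (f j).toKIdx (qKnitOfRecord N θ (f j).toKIdx) (qsKnitOfRecord N θ (f j).toKIdx)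
              (parKnitY (f j).toKIdx) (GpY (f j).toKIdx (parKnitY (f j).toKIdx)) U) ∧
            PosDefTr (fun _ => (1 : ℝ)) (deltaAQY (f j).toKIdx (qKnitOfRecord N θ (f j).toKIdx) (qsKnitOfRecord N θ (f j).toKIdx)
              (parKnitY (f j).toKIdx) (GpY (f j).toKIdx (parKnitY (f j).toKIdx)) U) := by
  obtain ⟨M₁, a₁, hM₁, ha₁, h⟩ := symm_posDefTr_deltaAQY_knitRecord_at_scMember_regYR (N := N) θ Mstar hc hRP1
  exact ⟨M₁, a₁, hM₁, ha₁, fun f ιB hι j hM α₀ hα ha U hU => h (f j) (fun s => ⟨ιB j s, hι j s⟩) hM α₀ hα ha U hU⟩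

end Row17

end Literature.MathematicalPhysics.QuantumFieldTheory.Balaban1983to89.B9KnitRows1517AlongSectionsY

end
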